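import Summits.Ventures.PercRepro.RankLevelSetIndepCD

/-! # RankLevelSetBiIndepLRFibre — THE FIBRE DECOMPOSITION OF (LR): (★★) AT THE NEAR-MIDDLE LEVEL FOR THE INTERSECTION
COMPLEXES `I(M / W) ∩ I(M / R)` OF COMPLEMENTARY CONTRACTIONS IMPLIES (LR) (night-1 g27; dossier §39.6, §39.11)

Write `s = E ∖ {y}`. The through-`y` count `a_m = #{Q ∈ D_{m+1} : y ∈ Q}` is the number of `A ⊆ s` with `#A = m`,
`A ∪ {y}` independent and `s ∖ A` independent (`A = Q ∖ {y}`), and the avoid-`y` count `b_m = #{Z ∈ D_m : y ∉ Z}` the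
number of `B ⊆ s` with `#B = m`, `B` independent and `(s ∖ B) ∪ {y}` independent. Grouping the pairs `(A, B)` counted
by `a_{k+1} · b_k` and by `a_k · b_{k+1}` by `(U, W) = (A ∪ B, A ∩ B)` and writing `V = U ∖ W`, `R = s ∖ U`,
`A = W ∪ A₀`, `B = W ∪ (V ∖ A₀)`, the fibre over `(U, W)` counts the `A₀ ⊆ V` (`#V = 2j + 1`, `j = k − #W`) with
`W ∪ A₀ ∪ {y}`, `R ∪ (V ∖ A₀)`, `W ∪ (V ∖ A₀)` and `R ∪ A₀ ∪ {y}` independent (`lrFibre M y W R V m`), of size `j + 1`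
on the left and `j` on the right — i.e. the sets `A₀ ∪ {y}` and `V ∖ A₀` that are bi-𝒥 for the INTERSECTION COMPLEX
`𝒥 = I(M / W) ∩ I(M / R)` on `V ∪ {y}`, and the inequality is (★★) at the last level below the middle for that
complex (`RelLRMid M`, stated in `M`; a `Prop`, NOT asserted). **`biIndepLRStep_of_relLRMid : RelLRMid M →
BiIndepLRStep M`**: the consecutive form of (LR) follows from the relative near-middle (★★) of the intersection
complexes — the reason (LR) is harder than (CD), whose fibres are the MINORS `(M / W) | (V ∪ {e})`
(`RankLevelSetIndepCDMinor`). CENSUS: the fibre identity verified exactly on 138,788 fibres (n ≤ 7); the relative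
inequality holds on every fibre of every matroid ≤ 9 elements (monomial-positivity of the weighted (LR), kit j311232)
and on random two-matroid intersections up to 12 elements — BUT `RelLRMid` IS FALSE IN GENERAL (ERRATUM, night-1 g27,
dossier §39.14): on the theta graph Θ(1,2,3,3,4) (13 edges) at `y` = an edge of the length-2 path, with `W` = its
series partner, `#V = 7` and `R` two edges from each of two long paths, the fibre counts are `#lrFibre 3 = 8 <
#lrFibre 4 = 12` (54 negative patterns of the weighted (LR) difference at `k = 4`), while (LR) itself holds there. So
the bridge stands as a theorem but its hypothesis is not a route to (LR): the monomial-positivity of the weighted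
(LR) fails at 13 elements, unlike (conjecturally) that of (CD), whose fibres are matroids. Every declaration has a
docstring; imports: the cell's own modules and Mathlib only. Axioms: standard. -/

namespace PercRepro

open Set Matroid Finset

variable {α : Type} (M : Matroid α) [M.Finite]

omit [M.Finite] in
/-- The `A₀`-sets of an (LR)-fibre: `A₀ ⊆ V` with `#A₀ = m` such that `W ∪ A₀ ∪ {y}`, `R ∪ (V ∖ A₀)`, `W ∪ (V ∖ A₀)`
and `R ∪ A₀ ∪ {y}` are independent. -/
def lrFibre (y : α) (W R V : Set α) (m : ℕ) : Set (Set α) :=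
  {A₀ : Set α | A₀ ⊆ V ∧ A₀.ncard = m ∧ M.Indep (insert y (W ∪ A₀)) ∧ M.Indep (R ∪ (V \ A₀)) ∧
    M.Indep (W ∪ (V \ A₀)) ∧ M.Indep (insert y (R ∪ A₀))}

omit [M.Finite] in
/-- **The relative near-middle (★★) for the intersection complexes** (a `Prop`, NOT asserted): for `y ∈ E`, every
partition `E ∖ {y} = W ⊔ V ⊔ R` with `#V = 2j + 1`, `#lrFibre (j + 1) ≤ #lrFibre j`. -/
def RelLRMid : Prop :=
  ∀ y ∈ M.E, ∀ W V R : Set α, W ∪ V ∪ R = M.E \ {y} → Disjoint W V → Disjoint W R → Disjoint V R →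
    ∀ j : ℕ, V.ncard = 2 * j + 1 → (lrFibre M y W R V (j + 1)).ncard ≤ (lrFibre M y W R V j).ncard

/-- The through-`y` count as a count of subsets of `E ∖ {y}`: `a_m = #{A ⊆ E ∖ {y} : #A = m, A ∪ {y} and (E ∖ {y}) ∖ A
independent}` (`Q ↦ Q ∖ {y}`). -/
lemma yThroughCount_eq_subsets {y : α} (hy : y ∈ M.E) (m : ℕ) :
    yThroughCount M y m =
      {A : Set α | A ⊆ M.E \ {y} ∧ A.ncard = m ∧ M.Indep (insert y A) ∧ M.Indep ((M.E \ {y}) \ A)}.ncard := by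
  unfold yThroughCount
  refine Set.ncard_congr (fun Q _ => Q \ {y}) ?_ ?_ ?_
  · rintro Q ⟨⟨hQE, hQcard, hQind, hQcind⟩, hyQ⟩
    have hQeq : insert y (Q \ {y}) = Q := Set.insert_sdiff_singleton.trans (Set.insert_eq_of_mem hyQ)
    refine ⟨Set.sdiff_subset_sdiff_left hQE, ?_, ?_, ?_⟩
    · rw [Set.ncard_sdiff_singleton_of_mem hyQ, hQcard]; rfl
    · rw [hQeq]; exact hQind
    · have e : (M.E \ {y}) \ (Q \ {y}) = M.E \ Q := by
        ext x
        simp only [Set.mem_sdiff, Set.mem_singleton_iff, not_and, not_not]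
        constructor
        · rintro ⟨⟨hxE, hxy⟩, hx⟩
          exact ⟨hxE, fun hxQ => hxy (hx hxQ)⟩
        · rintro ⟨hxE, hxQ⟩
          exact ⟨⟨hxE, fun hxy => hxQ (hxy ▸ hyQ)⟩, fun hxQ' => absurd hxQ' hxQ⟩
      rw [e]; exact hQcind
  · rintro Q Q' ⟨-, hyQ⟩ ⟨-, hyQ'⟩ hQQ'
    have e1 : Q = insert y (Q \ {y}) := (Set.insert_sdiff_singleton.trans (Set.insert_eq_of_mem hyQ)).symm
    have e2 : Q' = insert y (Q' \ {y}) := (Set.insert_sdiff_singleton.trans (Set.insert_eq_of_mem hyQ')).symm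
    rw [e1, e2, hQQ']
  · rintro A ⟨hAE, hAcard, hind, hcind⟩
    have hyA : y ∉ A := fun hmem => (hAE hmem).2 rfl
    have hAfin : A.Finite := M.ground_finite.subset (hAE.trans Set.sdiff_subset)
    have e : M.E \ insert y A = (M.E \ {y}) \ A := by
      ext x
      simp only [Set.mem_sdiff, Set.mem_insert_iff, Set.mem_singleton_iff, not_or]
      tauto
    refine ⟨insert y A, ⟨⟨Set.insert_subset hy (hAE.trans Set.sdiff_subset), ?_, hind, ?_⟩,
      Set.mem_insert y A⟩, ?_⟩
    · rw [Set.ncard_insert_of_notMem hyA hAfin, hAcard]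
    · rw [e]; exact hcind
    · show insert y A \ {y} = A
      rw [Set.insert_sdiff_of_mem _ (Set.mem_singleton y), Set.sdiff_singleton_eq_self hyA]

omit [M.Finite] in
/-- The avoid-`y` count as a count of subsets of `E ∖ {y}`: `b_m = #{B ⊆ E ∖ {y} : #B = m, B and ((E ∖ {y}) ∖ B) ∪ {y}
independent}`. -/
lemma yAvoidCount_eq_subsets {y : α} (hy : y ∈ M.E) (m : ℕ) :
    yAvoidCount M y m =
      {B : Set α | B ⊆ M.E \ {y} ∧ B.ncard = m ∧ M.Indep B ∧ M.Indep (insert y ((M.E \ {y}) \ B))}.ncard := by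
  unfold yAvoidCount
  congr 1
  ext Z
  simp only [Set.mem_setOf_eq]
  constructor
  · rintro ⟨⟨hZE, hZcard, hZind, hZcind⟩, hyZ⟩
    have e : insert y ((M.E \ {y}) \ Z) = M.E \ Z := by
      ext x
      simp only [Set.mem_insert_iff, Set.mem_sdiff, Set.mem_singleton_iff]
      constructor
      · rintro (rfl | ⟨⟨hxE, -⟩, hxZ⟩)
        · exact ⟨hy, hyZ⟩
        · exact ⟨hxE, hxZ⟩
      · rintro ⟨hxE, hxZ⟩
        by_cases hxy : x = y
        · exact Or.inl hxy
        · exact Or.inr ⟨⟨hxE, hxy⟩, hxZ⟩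
    refine ⟨fun x hx => ⟨hZE hx, fun hxy => hyZ (hxy ▸ hx)⟩, hZcard, hZind, ?_⟩
    rw [e]; exact hZcind
  · rintro ⟨hZE, hZcard, hZind, hZcind⟩
    have hyZ : y ∉ Z := fun hmem => (hZE hmem).2 rfl
    have e : insert y ((M.E \ {y}) \ Z) = M.E \ Z := by
      ext x
      simp only [Set.mem_insert_iff, Set.mem_sdiff, Set.mem_singleton_iff]
      constructor
      · rintro (rfl | ⟨⟨hxE, -⟩, hxZ⟩)
        · exact ⟨hy, hyZ⟩
        · exact ⟨hxE, hxZ⟩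
      · rintro ⟨hxE, hxZ⟩
        by_cases hxy : x = y
        · exact Or.inl hxy
        · exact Or.inr ⟨⟨hxE, hxy⟩, hxZ⟩
    refine ⟨⟨hZE.trans Set.sdiff_subset, hZcard, hZind, ?_⟩, hyZ⟩
    rw [← e]; exact hZcind

section Finsets

variable [DecidableEq α]

omit [M.Finite] in
open Classical in
/-- The through-`y` sets as a `Finset` over `s = E ∖ {y}`: `A ⊆ s`, `#A = m`, `A ∪ {y}` and `s ∖ A` independent. -/
noncomputable def throughFinset (s : Finset α) (y : α) (m : ℕ) : Finset (Finset α) :=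
  s.powerset.filter (fun A : Finset α => A.card = m ∧ M.Indep (insert y ↑A) ∧ M.Indep ((↑s : Set α) \ ↑A))

omit [M.Finite] in
open Classical in
/-- The avoid-`y` sets as a `Finset` over `s = E ∖ {y}`: `B ⊆ s`, `#B = m`, `B` and `(s ∖ B) ∪ {y}` independent. -/
noncomputable def avoidFinset (s : Finset α) (y : α) (m : ℕ) : Finset (Finset α) :=
  s.powerset.filter (fun B : Finset α => B.card = m ∧ M.Indep (↑B : Set α) ∧ M.Indep (insert y ((↑s : Set α) \ ↑B)))

omit [M.Finite] in
open Classical in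
/-- The (LR)-fibre sets as a `Finset` of `Finset`s. -/
noncomputable def lrFibreFinset (y : α) (W R V : Finset α) (m : ℕ) : Finset (Finset α) :=
  V.powerset.filter (fun A₀ : Finset α => A₀.card = m ∧ M.Indep (insert y ↑(W ∪ A₀)) ∧ M.Indep ↑(R ∪ (V \ A₀)) ∧
    M.Indep ↑(W ∪ (V \ A₀)) ∧ M.Indep (insert y ↑(R ∪ A₀)))

omit [DecidableEq α] in
open Classical in
/-- `a_m` as a `Finset` count over `s = E ∖ {y}`. -/
lemma yThroughCount_eq_card {y : α} (hy : y ∈ M.E) (s : Finset α) (hs : (↑s : Set α) = M.E \ {y}) (m : ℕ) :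
    yThroughCount M y m = (throughFinset M s y m).card := by
  rw [yThroughCount_eq_subsets M hy m, ← hs]
  unfold throughFinset
  rw [ncard_subsets_eq_card_filter s (fun A : Set α => A.ncard = m ∧ M.Indep (insert y A) ∧ M.Indep (↑s \ A))]
  refine congrArg Finset.card ?_
  ext A
  simp only [Finset.mem_filter, Finset.mem_powerset, Set.ncard_coe_finset]

omit [M.Finite] [DecidableEq α] in
open Classical in
/-- `b_m` as a `Finset` count over `s = E ∖ {y}`. -/
lemma yAvoidCount_eq_card {y : α} (hy : y ∈ M.E) (s : Finset α) (hs : (↑s : Set α) = M.E \ {y}) (m : ℕ) :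
    yAvoidCount M y m = (avoidFinset M s y m).card := by
  rw [yAvoidCount_eq_subsets M hy m, ← hs]
  unfold avoidFinset
  rw [ncard_subsets_eq_card_filter s
    (fun B : Set α => B.ncard = m ∧ M.Indep B ∧ M.Indep (insert y (↑s \ B)))]
  refine congrArg Finset.card ?_
  ext B
  simp only [Finset.mem_filter, Finset.mem_powerset, Set.ncard_coe_finset]

omit [M.Finite] in
open Classical in
/-- The fibre sets as a `Finset` count. -/
lemma ncard_lrFibre_eq (y : α) (W R V : Finset α) (m : ℕ) :
    (lrFibre M y ↑W ↑R ↑V m).ncard = (lrFibreFinset M y W R V m).card := by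
  unfold lrFibre lrFibreFinset
  rw [ncard_subsets_eq_card_filter V (fun A₀ : Set α => A₀.ncard = m ∧ M.Indep (insert y (↑W ∪ A₀)) ∧
    M.Indep (↑R ∪ (↑V \ A₀)) ∧ M.Indep (↑W ∪ (↑V \ A₀)) ∧ M.Indep (insert y (↑R ∪ A₀)))]
  refine congrArg Finset.card ?_
  ext A₀
  simp only [Finset.mem_filter, Finset.mem_powerset, Set.ncard_coe_finset, Finset.coe_union, Finset.coe_sdiff]

omit [M.Finite] in
/-- Set algebra of an (LR)-fibre: for `W ⊆ A ⊆ U ⊆ s`, `s ∖ A = (s ∖ U) ∪ ((U ∖ W) ∖ (A ∖ W))`. -/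
lemma sdiff_eq_union_fibre {s U W A : Finset α} (hWA : W ⊆ A) (hAU : A ⊆ U) (hUs : U ⊆ s) :
    s \ A = (s \ U) ∪ ((U \ W) \ (A \ W)) := by
  ext x
  simp only [Finset.mem_sdiff, Finset.mem_union]
  have h1 : x ∈ W → x ∈ A := fun hx => hWA hx
  have h2 : x ∈ A → x ∈ U := fun hx => hAU hx
  have h3 : x ∈ U → x ∈ s := fun hx => hUs hx
  tauto

omit [M.Finite] in
/-- Set algebra of an (LR)-fibre: for `A₀ ⊆ U ∖ W`, `W ⊆ U ⊆ s`, `s ∖ (W ∪ A₀) = (s ∖ U) ∪ ((U ∖ W) ∖ A₀)`. -/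
lemma sdiff_union_eq_fibre {s U W A₀ : Finset α} (hWU : W ⊆ U) (hUs : U ⊆ s) (hA₀ : A₀ ⊆ U \ W) :
    s \ (W ∪ A₀) = (s \ U) ∪ ((U \ W) \ A₀) := by
  ext x
  simp only [Finset.mem_sdiff, Finset.mem_union]
  have h1 : x ∈ A₀ → x ∈ U ∧ x ∉ W := fun hx => Finset.mem_sdiff.mp (hA₀ hx)
  have h2 : x ∈ W → x ∈ U := fun hx => hWU hx
  have h3 : x ∈ U → x ∈ s := fun hx => hUs hx
  tauto

omit [M.Finite] in
/-- Set algebra of an (LR)-fibre: for `A₀ ⊆ U ∖ W`, `W ⊆ U ⊆ s`, `s ∖ (W ∪ ((U ∖ W) ∖ A₀)) = (s ∖ U) ∪ A₀`. -/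
lemma sdiff_union_sdiff_eq_fibre {s U W A₀ : Finset α} (hWU : W ⊆ U) (hUs : U ⊆ s) (hA₀ : A₀ ⊆ U \ W) :
    s \ (W ∪ ((U \ W) \ A₀)) = (s \ U) ∪ A₀ := by
  ext x
  simp only [Finset.mem_sdiff, Finset.mem_union]
  have h1 : x ∈ A₀ → x ∈ U ∧ x ∉ W := fun hx => Finset.mem_sdiff.mp (hA₀ hx)
  have h2 : x ∈ W → x ∈ U := fun hx => hWU hx
  have h3 : x ∈ U → x ∈ s := fun hx => hUs hx
  tauto

omit [M.Finite] in
open Classical in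
/-- **The (LR)-fibre over `(U, W)` is a set of `A₀`'s**: the pairs `(A, B)` with `A` an `m`-set of `throughFinset`, `B`
an `m'`-set of `avoidFinset`, `A ∪ B = U`, `A ∩ B = W`, correspond by `A ↦ A ∖ W` to the `A₀ ⊆ U ∖ W` of `lrFibre`
for `R = s ∖ U` (`#A₀ = m − #W`, `#(U ∖ W) − #A₀ = m' − #W`). -/
lemma lr_fibre_card_eq (y : α) (s U W : Finset α) (m m' m₀ : ℕ) (hm : m = W.card + m₀)
    (hm' : m' = W.card + ((U \ W).card - m₀)) (hWU : W ⊆ U) (hUs : U ⊆ s) :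
    ((throughFinset M s y m ×ˢ avoidFinset M s y m').filter
      (fun p : Finset α × Finset α => (p.1 ∪ p.2, p.1 ∩ p.2) = (U, W))).card =
      (lrFibre M y ↑W ↑(s \ U) ↑(U \ W) m₀).ncard := by
  rw [ncard_lrFibre_eq]
  have hWs : W ⊆ s := hWU.trans hUs
  have hVs : U \ W ⊆ s := Finset.sdiff_subset.trans hUs
  refine Finset.card_nbij' (fun p => p.1 \ W) (fun A₀ => (W ∪ A₀, W ∪ ((U \ W) \ A₀))) ?_ ?_ ?_ ?_
  · rintro ⟨A, B⟩ hp
    rw [Finset.mem_coe, Finset.mem_filter, Finset.mem_product] at hp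
    obtain ⟨⟨hA, hB⟩, hf⟩ := hp
    simp only [throughFinset, avoidFinset, Finset.mem_filter, Finset.mem_powerset] at hA hB
    simp only [Prod.mk.injEq] at hf
    obtain ⟨hU, hW⟩ := hf
    have hWA : W ⊆ A := by rw [← hW]; exact Finset.inter_subset_left
    have hAU : A ⊆ U := by rw [← hU]; exact Finset.subset_union_left
    have hWB : W ⊆ B := by rw [← hW]; exact Finset.inter_subset_right
    have hBU : B ⊆ U := by rw [← hU]; exact Finset.subset_union_right
    have hAeq : W ∪ (A \ W) = A := Finset.union_sdiff_of_subset hWA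
    have hBeq : W ∪ ((U \ W) \ (A \ W)) = B := fibre_second_eq hU hW
    have hsA : s \ A = (s \ U) ∪ ((U \ W) \ (A \ W)) := sdiff_eq_union_fibre hWA hAU hUs
    have hsB : s \ B = (s \ U) ∪ (A \ W) := by
      rw [← hBeq]
      exact sdiff_union_sdiff_eq_fibre hWU hUs (Finset.sdiff_subset_sdiff hAU le_rfl)
    unfold lrFibreFinset
    rw [Finset.mem_coe, Finset.mem_filter, Finset.mem_powerset]
    refine ⟨Finset.sdiff_subset_sdiff hAU le_rfl, ?_, ?_, ?_, ?_, ?_⟩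
    · rw [Finset.card_sdiff, Finset.inter_eq_left.mpr hWA, hA.2.1]; omega
    · rw [hAeq]; exact hA.2.2.1
    · rw [← hsA, Finset.coe_sdiff]; exact hA.2.2.2
    · rw [hBeq]; exact hB.2.2.1
    · rw [← hsB, Finset.coe_sdiff]; exact hB.2.2.2
  · intro A₀ hA₀
    unfold lrFibreFinset at hA₀
    rw [Finset.mem_coe, Finset.mem_filter, Finset.mem_powerset] at hA₀
    obtain ⟨hA₀V, hA₀card, hind₁, hind₂, hind₃, hind₄⟩ := hA₀
    have hdisj₀ : Disjoint W A₀ := by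
      refine Finset.disjoint_left.mpr (fun x hxW hxA => ?_)
      exact (Finset.mem_sdiff.mp (hA₀V hxA)).2 hxW
    have hdisj₁ : Disjoint W ((U \ W) \ A₀) := by
      refine Finset.disjoint_left.mpr (fun x hxW hx => ?_)
      exact (Finset.mem_sdiff.mp (Finset.mem_sdiff.mp hx).1).2 hxW
    have hsA : s \ (W ∪ A₀) = (s \ U) ∪ ((U \ W) \ A₀) := sdiff_union_eq_fibre hWU hUs hA₀V
    have hsB : s \ (W ∪ ((U \ W) \ A₀)) = (s \ U) ∪ A₀ := sdiff_union_sdiff_eq_fibre hWU hUs hA₀V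
    rw [Finset.mem_coe, Finset.mem_filter, Finset.mem_product]
    refine ⟨⟨?_, ?_⟩, ?_⟩
    · unfold throughFinset
      rw [Finset.mem_filter, Finset.mem_powerset]
      refine ⟨Finset.union_subset hWs (hA₀V.trans hVs), ?_, hind₁, ?_⟩
      · rw [Finset.card_union_of_disjoint hdisj₀, hA₀card, hm]
      · rw [← Finset.coe_sdiff, hsA]; exact hind₂
    · unfold avoidFinset
      rw [Finset.mem_filter, Finset.mem_powerset]
      refine ⟨Finset.union_subset hWs (Finset.sdiff_subset.trans hVs), ?_, hind₃, ?_⟩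
      · rw [Finset.card_union_of_disjoint hdisj₁, Finset.card_sdiff, Finset.inter_eq_left.mpr hA₀V, hA₀card, hm']
      · rw [← Finset.coe_sdiff, hsB]; exact hind₄
    · simp only [Prod.mk.injEq]
      exact ⟨fibre_union_eq hWU hA₀V, fibre_inter_eq hA₀V⟩
  · rintro ⟨A, B⟩ hp
    rw [Finset.mem_coe, Finset.mem_filter, Finset.mem_product] at hp
    obtain ⟨-, hf⟩ := hp
    simp only [Prod.mk.injEq] at hf
    obtain ⟨hU, hW⟩ := hf
    have hWA : W ⊆ A := by rw [← hW]; exact Finset.inter_subset_left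
    have hAeq : W ∪ (A \ W) = A := Finset.union_sdiff_of_subset hWA
    have hBeq : W ∪ ((U \ W) \ (A \ W)) = B := fibre_second_eq hU hW
    simp only [hAeq, hBeq]
  · intro A₀ hA₀
    unfold lrFibreFinset at hA₀
    rw [Finset.mem_coe, Finset.mem_filter, Finset.mem_powerset] at hA₀
    have hdisj₀ : Disjoint W A₀ := by
      refine Finset.disjoint_left.mpr (fun x hxW hxA => ?_)
      exact (Finset.mem_sdiff.mp (hA₀.1 hxA)).2 hxW
    simp only
    rw [Finset.union_sdiff_cancel_left hdisj₀]

omit [M.Finite] in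
/-- Set algebra: for `W ⊆ U ⊆ s`, `W ∪ (U ∖ W) ∪ (s ∖ U) = s`. -/
lemma union_sdiff_union_sdiff_eq {s U W : Finset α} (hWU : W ⊆ U) (hUs : U ⊆ s) :
    W ∪ (U \ W) ∪ (s \ U) = s := by
  ext x
  simp only [Finset.mem_union, Finset.mem_sdiff]
  have h1 : x ∈ W → x ∈ U := fun hx => hWU hx
  have h2 : x ∈ U → x ∈ s := fun hx => hUs hx
  tauto

end Finsets

/-- **THE RELATIVE NEAR-MIDDLE (★★) OF THE INTERSECTION COMPLEXES IMPLIES (LR)**: `RelLRMid M → BiIndepLRStep M`. -/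
theorem biIndepLRStep_of_relLRMid (h : RelLRMid M) : BiIndepLRStep M := by
  classical
  intro y hy k
  set s : Finset α := M.ground_finite.toFinset.erase y with hs
  have hs_coe : (↑s : Set α) = M.E \ {y} := by
    ext x
    simp only [hs, Finset.coe_erase, M.ground_finite.coe_toFinset]
  rw [yThroughCount_eq_card M hy s hs_coe, yThroughCount_eq_card M hy s hs_coe, yAvoidCount_eq_card M hy s hs_coe,
    yAvoidCount_eq_card M hy s hs_coe, ← Finset.card_product, ← Finset.card_product]
  set f : Finset α × Finset α → Finset α × Finset α := fun p => (p.1 ∪ p.2, p.1 ∩ p.2) with hfdef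
  set t : Finset (Finset α × Finset α) := s.powerset ×ˢ s.powerset with htdef
  have hmem : ∀ {m m' : ℕ} (p : Finset α × Finset α), p ∈ throughFinset M s y m ×ˢ avoidFinset M s y m' →
      f p ∈ t := by
    intro m m' p hp
    rw [Finset.mem_product] at hp
    obtain ⟨hA, hB⟩ := hp
    simp only [throughFinset, avoidFinset, Finset.mem_filter, Finset.mem_powerset] at hA hB
    simp only [htdef, hfdef, Finset.mem_product, Finset.mem_powerset]
    exact ⟨Finset.union_subset hA.1 hB.1, (Finset.inter_subset_left).trans hA.1⟩
  rw [Finset.card_eq_sum_card_fiberwise (fun p hp => hmem p hp),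
    Finset.card_eq_sum_card_fiberwise (fun p hp => hmem p hp)]
  refine Finset.sum_le_sum (fun UW _ => ?_)
  obtain ⟨U, W⟩ := UW
  by_cases hL : ((throughFinset M s y (k + 1) ×ˢ avoidFinset M s y k).filter (fun p => f p = (U, W))).card = 0
  · rw [hL]; exact Nat.zero_le _
  obtain ⟨⟨A, B⟩, hAB⟩ := Finset.card_pos.mp (Nat.pos_of_ne_zero hL)
  rw [Finset.mem_filter, Finset.mem_product] at hAB
  obtain ⟨⟨hA, hB⟩, hf⟩ := hAB
  simp only [throughFinset, avoidFinset, Finset.mem_filter, Finset.mem_powerset] at hA hB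
  simp only [hfdef, Prod.mk.injEq] at hf
  obtain ⟨hU, hW⟩ := hf
  have hWU : W ⊆ U := by rw [← hU, ← hW]; exact Finset.inter_subset_left.trans Finset.subset_union_left
  have hWB : W ⊆ B := by rw [← hW]; exact Finset.inter_subset_right
  have hUs : U ⊆ s := by rw [← hU]; exact Finset.union_subset hA.1 hB.1
  have hcardUW : U.card + W.card = A.card + B.card := by
    rw [← hU, ← hW]; exact Finset.card_union_add_card_inter A B
  have hWk : W.card ≤ k := by
    have := Finset.card_le_card hWB; omega
  have hVcard : (U \ W).card = 2 * (k - W.card) + 1 := by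
    rw [Finset.card_sdiff, Finset.inter_eq_left.mpr hWU]; omega
  have hL' := lr_fibre_card_eq M y s U W (k + 1) k (k - W.card + 1) (by omega) (by omega) hWU hUs
  have hR' := lr_fibre_card_eq M y s U W k (k + 1) (k - W.card) (by omega) (by omega) hWU hUs
  simp only [hfdef]
  rw [hL', hR']
  refine h y hy ↑W ↑(U \ W) ↑(s \ U) ?_ ?_ ?_ ?_ (k - W.card) ?_
  · rw [← hs_coe, ← Finset.coe_union, ← Finset.coe_union, union_sdiff_union_sdiff_eq hWU hUs]
  · rw [Finset.coe_sdiff]; exact Set.disjoint_sdiff_right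
  · rw [Finset.coe_sdiff]
    exact Set.disjoint_of_subset_left (Finset.coe_subset.mpr hWU) Set.disjoint_sdiff_right
  · rw [Finset.coe_sdiff, Finset.coe_sdiff]
    exact Set.disjoint_of_subset_left Set.sdiff_subset Set.disjoint_sdiff_right
  · rw [Set.ncard_coe_finset, hVcard]

end PercRepro
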